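/-
Origin: expansion seat `prover-pub-hodgecm-mc-binder-1-g17-0`, handover #92r2 2026-08-20T22:31:33Z md5 9d5853e983c0 (285 l.; REPLACE of HodgeCM/Model/Binders/JLiuHJOfLiftType.lean — PKG file now 665fa43df520 (289 l., incl. packager Origin header); body of record 6f9b3d20a02c (285 l.) → 9d5853e983c0; owner binder-2 #92 (RUN 64) — CONSENT: binder-2-g18 STATUS l.14543; token strike only (18 tokens)) (`HOME/mc/pub-hodgecm-mc-binder-1-g17/campaign/new/Binders/JLiuHJOfLiftType.lean`, md5 9d5853e983c0, 285 lines);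
landed by the gen-27 packager (p-g27) in gate run 65 REPLACES the earlier landed copy of `HodgeCM/Model/Binders/JLiuHJOfLiftType.lean` (verbatim).
-/
/-
Copyright (c) 2026 the pub-hodgecm formalisation cell (harness21).  New file, not vendored.
Origin: session prover-pub-hodgecm-mc-binder-2-g18-0 (unit pub-hodgecm-mc-binder-2-g18, BINDER PROVER gen 18 of lineage mc-binder-2;
content lane (J-Liu-Θ), items (J5-corner) ∕ (J4a-socket) — the binder-2 share of the `hJ` socket of the (J3) junction behind E's
row 9 `hΘ`), 2026-08-20.  Intended final place: `HodgeCM/Model/Binders/JLiuHJOfLiftType.lean` (NEW additive leaf; imports the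
landed binder-2 #91 `Model/Binders/JLiuCornerOfReflex` (RUN 62), binder-1 #R116 `Model/HsmallOfTower` (RUN 63) and axioms-1 #3
`Model/LiuDictionaryBelow` (RUN 63); nothing imports it).
-/
import Summits.HodgeConjecture.HodgeCM.Model.Binders.JLiuCornerOfReflex
import Summits.HodgeConjecture.HodgeCM.Model.HsmallOfTower
import Summits.HodgeConjecture.HodgeCM.Model.LiuDictionaryBelow

set_option autoImplicit false

/-!
# (J4a) + (J5) ⇒ the first two clauses of the junction's `hJ`

The (J3) junction theorems behind E's row 9 — axioms-1-g15's `subset_span_of_liuDictionary(_le)` ∕ `hsmall_of_liuDictionary(_le)`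
(`Model/LiuDictionary`, `Model/LiuDictionaryBelow`), binder-1-g16's tower forms `subset_span_of_tower` ∕ `hsmall_of_tower`
(`Model/HThetaOfTower`, `Model/HsmallOfTower`) and the pointwise `hsmall_of_tower_at` (binder-1 #R120) — take, per scoped good sextic
context `c` and index `i`, a finite set `S` of characters `μ` with THREE clauses:

1. `hΦ`      : `∀ μ ∈ S, PhiMu μ` — Liu's «`τ' ∈ Φ_μ`» at `τ' = ι₁` ([Liu21] Thm. 4.15 ∕ (4.3));
2. `hcorner` : `∀ μ ∈ S, ∀ d, adm μ d → d.IsCorner c.K (c.Ψ i) c.σ` — every CM record admissible for `μ` matches the corner;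
3. the (J2)+(J4) lift ∕ family clause (`hIso` ∕ `hfam`) — sinst-1 ∕ binder-1.

This leaf DISCHARGES CLAUSES 1 AND 2 in the kernel from the single (J4a) identification of the theta lane (theta-3-g22 READ
`J4A-THETA-READ.g22.md` (L1)–(L5), theta-3-g26 l.14389 (i)): for every `μ ∈ S`,

  (J4a)  `typeOf μ = SignRecipe.liftType false c.K L j ι₁ (c.Ψ i)` for the guard's embedding `j : c.K → L`, `ι₁ ∘ j = c.σ`,

consumed in its weakest form `∃ j, ι₁.comp j = c.σ ∧ typeOf μ = liftType false c.K L j ι₁ (c.Ψ i)` (`j` is unique, `eq_of_comp_eq`),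
provided the dictionary's `PhiMu` ∕ `adm` are READ OFF the type `typeOf μ : CMType L` of `μ` as
`ι₁ ∈ typeOf μ → PhiMu μ` (`hPhi`; definitional for Liu's `Φ_μ`) and `adm μ d → d.IsReflexOfTypeG ι₁ (typeOf μ)` (`hadm`; definitional
for the instance `adm := fun p d => d.IsReflexOfTypeG ι₁ (typeOf p)` of axioms-1-g15's `liuDictionaryOfWeil`, RUN-64 kit #4, and the
intended instance named in `Model/LiuDictionary`'s CONTRACT docstring):

* clause 1 is `SignRecipe.self_mem_liftType_false_iff` + the guard's `c.σ ∈ Ψ_i` (`GoodCtx.mem`);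
* clause 2 is binder-2 #91 `LiuCMSide.isCorner_of_scope` at E's (D1) scope conjunction
  `finrank ℚ c.K = 6 ∧ IsNormalClosure ℚ c.K L ∧ ([L:ℚ] = 24 ∨ [L:ℚ] = 48)` (verbatim the `h6` of E's rows).

Main declarations (all KERNEL; 0 records, nothing cited anew, no `def … : Prop`):
* `HodgeCM.Model.eq_of_comp_eq` — `ι₁ ∘ j = ι₁ ∘ j' → j = j'`; `liftTyped_iff_forall` — the `∃ j`/`∀ j` forms of (J4a) agree under a guard;
* `HodgeCM.Model.LiuCMSide.isCorner_of_scope_of_eq` — #91 `isCorner_of_scope` with `ι₁ ∘ j = σ`, `Φ = liftType false …` substituted;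
* `HodgeCM.Model.self_mem_of_liftTyped`, `HodgeCM.Model.isCorner_of_liftTyped` — clauses 1, 2 for one `μ`;
* **`HodgeCM.Model.hJ_at_of_liftTyped`** — THE POINTWISE SOCKET: from `(∃ S, (∀ μ ∈ S, (J4a)) ∧ Q S)` to
  `(∃ S, clause 1 ∧ clause 2 ∧ Q S)` for ANY third clause `Q` — feeds `hsmall_of_tower_at`'s `hJ` (with `hmem := hgood.mem i`) and the
  family forms below verbatim;
* `HodgeCM.Model.hThetaUnion_of_tower_of_liftTyped`, `HodgeCM.Model.hsmall_of_tower_of_liftTyped` — binder-1's #R116 with clauses 1–2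
  of `hJ` replaced by (J4a), under `hP : P V c → IsNormalClosure ℚ c.K L ∧ ([L:ℚ] = 24 ∨ 48)` (E's scope predicate supplies it);
* `HodgeCM.Model.hsmall_of_liuDictionary_le_of_liftTyped` — axioms-1's #3 likewise (datum-generic, `hIso` below a level).

After this leaf the binder-2 residual of row 9 on the (J3) route is NIL in the kernel; what clause 3 and (J4a) still want is the theta
lane's per-slot identification and sinst-1's families.  The desk's CONTRACT audit of `adm` (Liu's own CM data for `μ` is admissible:
[Liu21] Def. 4.3 (2)) is untouched.  Expected `#print axioms` ⊆ {propext, Classical.choice, Quot.sound}.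
-/

noncomputable section

open Function Set
open NumberField
open Literature.AlgebraicGeometry.Motives
open Literature.AlgebraicGeometry.ShimuraVarieties
open Literature.AlgebraicGeometry.HodgeTheory
open Literature.NumberTheory.Automorphic
open Literature.NumberTheory.Automorphic.PicardCM
open Literature.NumberTheory.Transcendental (Arapura2012_Cor_15_4_6)

namespace HodgeCM.Model

open HodgeCM.SignRecipe (liftType)

/-! ## 0. The guard's embedding is unique -/

section Unique

variable {L : CMField} {ι₁ : L →+* ℂ} {K : CMField}

/-- `ι₁` is injective, so the embedding `j : K → L` under `σ = ι₁ ∘ j` is unique. -/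
theorem eq_of_comp_eq {j j' : K →+* L} (h : ι₁.comp j = ι₁.comp j') : j = j' :=
  RingHom.ext fun x => ι₁.injective (by simpa only [RingHom.comp_apply] using DFunLike.congr_fun h x)

/-- Under a guard providing SOME `j₀` with `ι₁ ∘ j₀ = σ` (`GoodCtx.forced`), the `∃ j`- and `∀ j`-forms of the (J4a) typing agree. -/
theorem liftTyped_iff_forall {σ : K →+* ℂ} (hσ : ∃ j₀ : K →+* L, ι₁.comp j₀ = σ) (Ψ : CMType K) (Φ : CMType L) :
    (∃ j : K →+* L, ι₁.comp j = σ ∧ Φ = liftType false K L j ι₁ Ψ) ↔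
      ∀ j : K →+* L, ι₁.comp j = σ → Φ = liftType false K L j ι₁ Ψ := by
  constructor
  · rintro ⟨j, hj, hΦ⟩ j' hj'
    rwa [eq_of_comp_eq (hj'.trans hj.symm)]
  · intro h
    obtain ⟨j₀, hj₀⟩ := hσ
    exact ⟨j₀, hj₀, h j₀ hj₀⟩

end Unique

/-! ## 1. (J5-corner) with the guard's `σ` and the (J4a) type substituted -/

namespace LiuCMSide

variable {L : CMField} {ι₁ : L →+* ℂ} {K : CMField}

/-- **(J5-corner) at PerL's scope, substituted form**: binder-2 #91 `isCorner_of_scope` with the guard's `ι₁ ∘ j = σ` and the (J4a)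
identification `Φ = liftType false K L j ι₁ Ψ` as hypotheses, so that the conclusion reads `C.IsCorner K Ψ σ` on the nose. -/
theorem isCorner_of_scope_of_eq (hN : IsNormalClosure ℚ K L) (hK : Module.finrank ℚ K = 6)
    (hL : Module.finrank ℚ L = 24 ∨ Module.finrank ℚ L = 48) {j : K →+* L} {σ : K →+* ℂ} (hj : ι₁.comp j = σ)
    (Ψ : CMType K) {Φ : CMType L} (hΦ : Φ = liftType false K L j ι₁ Ψ) (C : LiuCMSide) (h : C.IsReflexOfTypeG ι₁ Φ) :
    C.IsCorner K Ψ σ := by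
  subst hj hΦ
  exact isCorner_of_scope hN hK hL j Ψ C h

end LiuCMSide

/-! ## 2. Clauses 1 and 2 at one character, and the pointwise socket -/

section Socket

variable {L : CMField} {ι₁ : L →+* ℂ}

/-- **Clause 1 (`ι₁ ∈ Φ_μ`) from (J4a)**: the distinguished embedding lies in the recipe type `liftType false c.K L j ι₁ (c.Ψ i)` as soon
as `c.σ = ι₁ ∘ j ∈ Ψ_i` (`SignRecipe.self_mem_liftType_false_iff`; the guard's `GoodCtx.mem i`). -/
theorem self_mem_of_liftTyped {c : SeesawCtx L} {i : Fin 4} (hmem : c.σ ∈ (c.Ψ i).1) {Φ : CMType L}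
    (hΦ : ∃ j : c.K →+* L, ι₁.comp j = c.σ ∧ Φ = liftType false c.K L j ι₁ (c.Ψ i)) : ι₁ ∈ Φ.1 := by
  obtain ⟨j, hj, rfl⟩ := hΦ
  rw [SignRecipe.self_mem_liftType_false_iff, hj]
  exact hmem

/-- **Clause 2 (`hcorner`) from (J4a)** at E's (D1) scope conjunction: a CM record admissible in the Galois-guarded sense for the type
`Φ` matches the corner `(c.K, c.Ψ i, c.σ)` (binder-2 #91 `isCorner_of_scope`). -/
theorem isCorner_of_liftTyped {c : SeesawCtx L} {i : Fin 4}
    (h6 : Module.finrank ℚ c.K = 6 ∧ IsNormalClosure ℚ c.K L ∧ (Module.finrank ℚ L = 24 ∨ Module.finrank ℚ L = 48))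
    {Φ : CMType L} (hΦ : ∃ j : c.K →+* L, ι₁.comp j = c.σ ∧ Φ = liftType false c.K L j ι₁ (c.Ψ i))
    (d : LiuCMSide) (hd : d.IsReflexOfTypeG ι₁ Φ) : d.IsCorner c.K (c.Ψ i) c.σ := by
  obtain ⟨j, hj, hΦ⟩ := hΦ
  exact LiuCMSide.isCorner_of_scope_of_eq h6.2.1 h6.1 h6.2.2 hj (c.Ψ i) hΦ d hd

/-- **THE POINTWISE SOCKET.**  For bare dictionary data `(PhiMu, adm)` on a character type `Char`, READ OFF a type map
`typeOf : Char → CMType L` (`hPhi`, `hadm`), at a corner `(c, i)` with `c.σ ∈ Ψ_i` and E's scope conjunction `h6`: a finite set `S` of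
characters satisfying (J4a) and any further clause `Q S` yields `S` with clauses 1, 2 and `Q S` — the `hJ` of binder-1's
`hsmall_of_tower_at` (#R120; `hmem := hgood.mem i`, `Q S :=` its `hfam` clause) and, per point, of every family form. -/
theorem hJ_at_of_liftTyped {Char : Type*} (PhiMu : Char → Prop) (adm : Char → LiuCMSide → Prop) (typeOf : Char → CMType L)
    (hPhi : ∀ μ, ι₁ ∈ (typeOf μ).1 → PhiMu μ) (hadm : ∀ μ d, adm μ d → d.IsReflexOfTypeG ι₁ (typeOf μ))
    {c : SeesawCtx L} {i : Fin 4} (hmem : c.σ ∈ (c.Ψ i).1)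
    (h6 : Module.finrank ℚ c.K = 6 ∧ IsNormalClosure ℚ c.K L ∧ (Module.finrank ℚ L = 24 ∨ Module.finrank ℚ L = 48))
    (Q : Finset Char → Prop)
    (hJ4 : ∃ S : Finset Char,
      (∀ μ ∈ S, ∃ j : c.K →+* L, ι₁.comp j = c.σ ∧ typeOf μ = liftType false c.K L j ι₁ (c.Ψ i)) ∧ Q S) :
    ∃ S : Finset Char,
      (∀ μ ∈ S, PhiMu μ) ∧ (∀ μ ∈ S, ∀ d : LiuCMSide, adm μ d → d.IsCorner c.K (c.Ψ i) c.σ) ∧ Q S := by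
  obtain ⟨S, hS, hQ⟩ := hJ4
  exact ⟨S, fun μ hμ => hPhi μ (self_mem_of_liftTyped hmem (hS μ hμ)),
    fun μ hμ d hd => isCorner_of_liftTyped h6 (hS μ hμ) d (hadm μ d hd), hQ⟩

end Socket

/-! ## 3. Family forms: binder-1's tower corollaries and axioms-1's `_le` corollary with clauses 1–2 discharged -/

section Family

open HodgeCM.Model.TowerLevel HodgeCM.Model.TowerCarrier HodgeCM.Literature.Theta HodgeCM.Literature.Theta.LiuAlbaneseModuleDatum
open HodgeCM.CMTypeOps (inflate)
open HodgeCM.Universe (ThetaModel)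

variable {hHD : exists_isReal_hodgeModel} {hI : hodgePQ_independent_of_hodgeModel}
  {h₁ : BallQuotientUniformised} {h₃ : CMAbelianVarietyRealised}

/-- **E's `hΘ∪` THROUGH THE TOWER, clauses 1–2 from (J4a).**  binder-1's `hThetaUnion_of_tower` with `PhiMu`, `adm` read off a
family of type maps `typeOf V : Char V → CMType L` and the first two clauses of `hJ` replaced by the (J4a) typing of the characters
in `S`; the scope predicate `P` must carry E's normal-closure ∕ degree conjunct (`hP`). -/
theorem hThetaUnion_of_tower_of_liftTyped (hA : Arapura2012_Cor_15_4_6)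
    (R : (picardCMUniverse hHD hI h₁ h₃).ThetaModel)
    (Char : ∀ {L : CMField} {ι₁ : L →+* ℂ}, HermSpace3 L ι₁ → Type)
    (Adm : ∀ {L : CMField} {ι₁ : L →+* ℂ} (V : HermSpace3 L ι₁), Char V → Type)
    (Ω : ∀ {L : CMField} {ι₁ : L →+* ℂ} (V : HermSpace3 L ι₁) (μ : Char V), Adm V μ → Type)
    [∀ {L : CMField} {ι₁ : L →+* ℂ} (V : HermSpace3 L ι₁) (μ : Char V) (a : Adm V μ), AddCommGroup (Ω V μ a)]
    [∀ {L : CMField} {ι₁ : L →+* ℂ} (V : HermSpace3 L ι₁) (μ : Char V) (a : Adm V μ), Module ℂ (Ω V μ a)]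
    [∀ {L : CMField} {ι₁ : L →+* ℂ} (V : HermSpace3 L ι₁) (μ : Char V) (a : Adm V μ), Module (adelicAlgebra V) (Ω V μ a)]
    [∀ {L : CMField} {ι₁ : L →+* ℂ} (V : HermSpace3 L ι₁) (μ : Char V) (a : Adm V μ), IsScalarTower ℂ (adelicAlgebra V) (Ω V μ a)]
    (PhiMu : ∀ {L : CMField} {ι₁ : L →+* ℂ} (V : HermSpace3 L ι₁), Char V → Prop)
    (adm : ∀ {L : CMField} {ι₁ : L →+* ℂ} (V : HermSpace3 L ι₁), Char V → LiuCMSide → Prop)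
    (typeOf : ∀ {L : CMField} {ι₁ : L →+* ℂ} (V : HermSpace3 L ι₁), Char V → CMType L)
    (hPhi : ∀ {L : CMField} {ι₁ : L →+* ℂ} (V : HermSpace3 L ι₁) (μ : Char V), ι₁ ∈ (typeOf V μ).1 → PhiMu V μ)
    (hadm : ∀ {L : CMField} {ι₁ : L →+* ℂ} (V : HermSpace3 L ι₁) (μ : Char V) (d : LiuCMSide),
      adm V μ d → d.IsReflexOfTypeG ι₁ (typeOf V μ))
    (hcite : ∀ {L : CMField} {ι₁ : L →+* ℂ} (V : HermSpace3 L ι₁),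
      (LiuDictionary.ofTower hHD hI h₁ h₃ hA V (Char V) (Adm V) (Ω V) (PhiMu V) (adm V)).Irreducible ∧
      (LiuDictionary.ofTower hHD hI h₁ h₃ hA V (Char V) (Adm V) (Ω V) (PhiMu V) (adm V)).Prop413 ∧
      (LiuDictionary.ofTower hHD hI h₁ h₃ hA V (Char V) (Adm V) (Ω V) (PhiMu V) (adm V)).Thm418_2 ∧
      (LiuDictionary.ofTower hHD hI h₁ h₃ hA V (Char V) (Adm V) (Ω V) (PhiMu V) (adm V)).MuSeparated ∧
      (LiuDictionary.ofTower hHD hI h₁ h₃ hA V (Char V) (Adm V) (Ω V) (PhiMu V) (adm V)).Thm418C)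
    (P : ∀ {L : CMField} {ι₁ : L →+* ℂ}, HermSpace3 L ι₁ → SeesawCtx L → Prop)
    (hP : ∀ {L : CMField} {ι₁ : L →+* ℂ} (V : HermSpace3 L ι₁) (c : SeesawCtx L), P V c →
      IsNormalClosure ℚ c.K L ∧ (Module.finrank ℚ L = 24 ∨ Module.finrank ℚ L = 48))
    (hJ4 : ∀ {L : CMField} {ι₁ : L →+* ℂ} (V : HermSpace3 L ι₁) (c : SeesawCtx L), P V c → R.GoodCtx ι₁ c →
      Module.finrank ℚ c.K = 6 → ∀ i : Fin 4, ∃ S : Finset (Char V),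
        (∀ μ ∈ S, ∃ j : c.K →+* L, ι₁.comp j = c.σ ∧ typeOf V μ = liftType false c.K L j ι₁ (c.Ψ i)) ∧
        ∀ (Γ : Level V) (hΓ : Γ.BelowConjThree), ∀ ω ∈ R.Theta V c i Γ,
          ∃ cf : towerLevel hHD hI (ballQuotientUniformisedDatum_of h₁) h₃ hA Γ hΓ,
            TowerLevel.res hHD hI (ballQuotientUniformisedDatum_of h₁) h₃ hA cf = ω ∧
              (ofLevel hHD hI (ballQuotientUniformisedDatum_of h₁) h₃ hA Γ hΓ cf :
                  (LiuDictionary.ofTower hHD hI h₁ h₃ hA V (Char V) (Adm V) (Ω V) (PhiMu V) (adm V)).H) ∈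
                ⨆ μ ∈ S, (LiuDictionary.ofTower hHD hI h₁ h₃ hA V (Char V) (Adm V) (Ω V) (PhiMu V) (adm V)).block μ) :
    ∀ {L : CMField} {ι₁ : L →+* ℂ} (V : HermSpace3 L ι₁) (c : SeesawCtx L), P V c → R.GoodCtx ι₁ c →
      Module.finrank ℚ c.K = 6 → ∀ i : Fin 4, ∃ Γ₀ : Level V, ∀ Γ ≤ Γ₀,
        R.Theta V c i Γ ⊆
          Submodule.span ℂ (⋃ D : CommonReflexInput c.K (c.Ψ i) c.σ, D.surfaceClasses hHD hI h₁ h₃ V Γ) :=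
  hThetaUnion_of_tower hA R Char Adm Ω PhiMu adm hcite P fun V c hPc hgood h6 i =>
    hJ_at_of_liftTyped (PhiMu V) (adm V) (typeOf V) (hPhi V) (hadm V) (hgood.mem i) ⟨h6, hP V c hPc⟩ _
      (hJ4 V c hPc hgood h6 i)

/-- **E's `hsmall` THROUGH THE TOWER, clauses 1–2 from (J4a)** (scoped by `P`, Riemann's fullness `hR`): binder-1's `hsmall_of_tower`
with the first two clauses of `hJ` replaced by the (J4a) typing. -/
theorem hsmall_of_tower_of_liftTyped (hR : DeligneMilne1982_Thm_6_20_full) (hA : Arapura2012_Cor_15_4_6)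
    (R : (picardCMUniverse hHD hI h₁ h₃).ThetaModel)
    (Char : ∀ {L : CMField} {ι₁ : L →+* ℂ}, HermSpace3 L ι₁ → Type)
    (Adm : ∀ {L : CMField} {ι₁ : L →+* ℂ} (V : HermSpace3 L ι₁), Char V → Type)
    (Ω : ∀ {L : CMField} {ι₁ : L →+* ℂ} (V : HermSpace3 L ι₁) (μ : Char V), Adm V μ → Type)
    [∀ {L : CMField} {ι₁ : L →+* ℂ} (V : HermSpace3 L ι₁) (μ : Char V) (a : Adm V μ), AddCommGroup (Ω V μ a)]
    [∀ {L : CMField} {ι₁ : L →+* ℂ} (V : HermSpace3 L ι₁) (μ : Char V) (a : Adm V μ), Module ℂ (Ω V μ a)]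
    [∀ {L : CMField} {ι₁ : L →+* ℂ} (V : HermSpace3 L ι₁) (μ : Char V) (a : Adm V μ), Module (adelicAlgebra V) (Ω V μ a)]
    [∀ {L : CMField} {ι₁ : L →+* ℂ} (V : HermSpace3 L ι₁) (μ : Char V) (a : Adm V μ), IsScalarTower ℂ (adelicAlgebra V) (Ω V μ a)]
    (PhiMu : ∀ {L : CMField} {ι₁ : L →+* ℂ} (V : HermSpace3 L ι₁), Char V → Prop)
    (adm : ∀ {L : CMField} {ι₁ : L →+* ℂ} (V : HermSpace3 L ι₁), Char V → LiuCMSide → Prop)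
    (typeOf : ∀ {L : CMField} {ι₁ : L →+* ℂ} (V : HermSpace3 L ι₁), Char V → CMType L)
    (hPhi : ∀ {L : CMField} {ι₁ : L →+* ℂ} (V : HermSpace3 L ι₁) (μ : Char V), ι₁ ∈ (typeOf V μ).1 → PhiMu V μ)
    (hadm : ∀ {L : CMField} {ι₁ : L →+* ℂ} (V : HermSpace3 L ι₁) (μ : Char V) (d : LiuCMSide),
      adm V μ d → d.IsReflexOfTypeG ι₁ (typeOf V μ))
    (hcite : ∀ {L : CMField} {ι₁ : L →+* ℂ} (V : HermSpace3 L ι₁),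
      (LiuDictionary.ofTower hHD hI h₁ h₃ hA V (Char V) (Adm V) (Ω V) (PhiMu V) (adm V)).Irreducible ∧
      (LiuDictionary.ofTower hHD hI h₁ h₃ hA V (Char V) (Adm V) (Ω V) (PhiMu V) (adm V)).Prop413 ∧
      (LiuDictionary.ofTower hHD hI h₁ h₃ hA V (Char V) (Adm V) (Ω V) (PhiMu V) (adm V)).Thm418_2 ∧
      (LiuDictionary.ofTower hHD hI h₁ h₃ hA V (Char V) (Adm V) (Ω V) (PhiMu V) (adm V)).MuSeparated ∧
      (LiuDictionary.ofTower hHD hI h₁ h₃ hA V (Char V) (Adm V) (Ω V) (PhiMu V) (adm V)).Thm418C)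
    (P : ∀ {L : CMField} {ι₁ : L →+* ℂ}, HermSpace3 L ι₁ → SeesawCtx L → Prop)
    (hP : ∀ {L : CMField} {ι₁ : L →+* ℂ} (V : HermSpace3 L ι₁) (c : SeesawCtx L), P V c →
      IsNormalClosure ℚ c.K L ∧ (Module.finrank ℚ L = 24 ∨ Module.finrank ℚ L = 48))
    (hJ4 : ∀ {L : CMField} {ι₁ : L →+* ℂ} (V : HermSpace3 L ι₁) (c : SeesawCtx L), P V c → R.GoodCtx ι₁ c →
      Module.finrank ℚ c.K = 6 → ∀ i : Fin 4, ∃ S : Finset (Char V),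
        (∀ μ ∈ S, ∃ j : c.K →+* L, ι₁.comp j = c.σ ∧ typeOf V μ = liftType false c.K L j ι₁ (c.Ψ i)) ∧
        ∀ (Γ : Level V) (hΓ : Γ.BelowConjThree), ∀ ω ∈ R.Theta V c i Γ,
          ∃ cf : towerLevel hHD hI (ballQuotientUniformisedDatum_of h₁) h₃ hA Γ hΓ,
            TowerLevel.res hHD hI (ballQuotientUniformisedDatum_of h₁) h₃ hA cf = ω ∧
              (ofLevel hHD hI (ballQuotientUniformisedDatum_of h₁) h₃ hA Γ hΓ cf :
                  (LiuDictionary.ofTower hHD hI h₁ h₃ hA V (Char V) (Adm V) (Ω V) (PhiMu V) (adm V)).H) ∈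
                ⨆ μ ∈ S, (LiuDictionary.ofTower hHD hI h₁ h₃ hA V (Char V) (Adm V) (Ω V) (PhiMu V) (adm V)).block μ) :
    ∀ {L : CMField} {ι₁ : L →+* ℂ} (V : HermSpace3 L ι₁) (c : SeesawCtx L), P V c → R.GoodCtx ι₁ c →
      Module.finrank ℚ c.K = 6 → ∀ i : Fin 4, ∃ Γ₀ : Level V, ∀ Γ ≤ Γ₀,
        ∃ (M : CMField) (k : c.K →+* M) (σ' : M →+* ℂ), σ'.comp k = c.σ ∧
          R.Theta V c i Γ ⊆ (picardCMUniverse hHD hI h₁ h₃).Uiso Γ M (inflate k (c.Ψ i)) σ' :=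
  hsmall_of_tower hR hA R Char Adm Ω PhiMu adm hcite P fun V c hPc hgood h6 i =>
    hJ_at_of_liftTyped (PhiMu V) (adm V) (typeOf V) (hPhi V) (hadm V) (hgood.mem i) ⟨h6, hP V c hPc⟩ _
      (hJ4 V c hPc hgood h6 i)

/-- **E's `hsmall` from a DATUM-GENERIC dictionary family, `hIso` below a level, clauses 1–2 from (J4a)**: axioms-1's
`hsmall_of_liuDictionary_le` (#3) with `(T V).PhiMu` ∕ `(T V).adm` read off type maps `typeOf V : (T V).Char → CMType L` and the first
two clauses of `hJ` replaced by the (J4a) typing. -/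
theorem hsmall_of_liuDictionary_le_of_liftTyped (hR : DeligneMilne1982_Thm_6_20_full)
    (R : (picardCMUniverse hHD hI h₁ h₃).ThetaModel)
    (T : ∀ {L : CMField} {ι₁ : L →+* ℂ} (V : HermSpace3 L ι₁), LiuDictionary hHD hI h₁ h₃ V)
    (typeOf : ∀ {L : CMField} {ι₁ : L →+* ℂ} (V : HermSpace3 L ι₁), (T V).Char → CMType L)
    (hPhi : ∀ {L : CMField} {ι₁ : L →+* ℂ} (V : HermSpace3 L ι₁) (μ : (T V).Char), ι₁ ∈ (typeOf V μ).1 → (T V).PhiMu μ)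
    (hadm : ∀ {L : CMField} {ι₁ : L →+* ℂ} (V : HermSpace3 L ι₁) (μ : (T V).Char) (d : LiuCMSide),
      (T V).adm μ d → d.IsReflexOfTypeG ι₁ (typeOf V μ))
    (hcite : ∀ {L : CMField} {ι₁ : L →+* ℂ} (V : HermSpace3 L ι₁),
      (T V).Irreducible ∧ (T V).Prop413 ∧ (T V).Thm418_2 ∧ (T V).MuSeparated ∧ (T V).Thm418C)
    (P : ∀ {L : CMField} {ι₁ : L →+* ℂ}, HermSpace3 L ι₁ → SeesawCtx L → Prop)
    (hP : ∀ {L : CMField} {ι₁ : L →+* ℂ} (V : HermSpace3 L ι₁) (c : SeesawCtx L), P V c →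
      IsNormalClosure ℚ c.K L ∧ (Module.finrank ℚ L = 24 ∨ Module.finrank ℚ L = 48))
    (hJ4 : ∀ {L : CMField} {ι₁ : L →+* ℂ} (V : HermSpace3 L ι₁) (c : SeesawCtx L), P V c → R.GoodCtx ι₁ c →
      Module.finrank ℚ c.K = 6 → ∀ i : Fin 4, ∃ S : Finset (T V).Char,
        (∀ μ ∈ S, ∃ j : c.K →+* L, ι₁.comp j = c.σ ∧ typeOf V μ = liftType false c.K L j ι₁ (c.Ψ i)) ∧
        ∃ Γ₁ : Level V, ∀ Γ ≤ Γ₁, ∀ ω ∈ R.Theta V c i Γ, ∃ x : (T V).H,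
          x ∈ fixedBy Γ.K (T V).H ∧ (T V).res Γ x = ω ∧ x ∈ ⨆ μ ∈ S, (T V).block μ) :
    ∀ {L : CMField} {ι₁ : L →+* ℂ} (V : HermSpace3 L ι₁) (c : SeesawCtx L), P V c → R.GoodCtx ι₁ c →
      Module.finrank ℚ c.K = 6 → ∀ i : Fin 4, ∃ Γ₀ : Level V, ∀ Γ ≤ Γ₀,
        ∃ (M : CMField) (k : c.K →+* M) (σ' : M →+* ℂ), σ'.comp k = c.σ ∧
          R.Theta V c i Γ ⊆ (picardCMUniverse hHD hI h₁ h₃).Uiso Γ M (inflate k (c.Ψ i)) σ' :=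
  hsmall_of_liuDictionary_le hR R T hcite P fun V c hPc hgood h6 i =>
    hJ_at_of_liftTyped ((T V).PhiMu) ((T V).adm) (typeOf V) (hPhi V) (hadm V) (hgood.mem i) ⟨h6, hP V c hPc⟩ _
      (hJ4 V c hPc hgood h6 i)

end Family

end HodgeCM.Model

end
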